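import Literature.Combinatorics.Games.ParityGame

/-!
# Positional determinacy of parity games on finite arenas — proof

This file discharges the named fact `ParityGame.PositionalDeterminacy` of
`Literature.Combinatorics.Games.ParityGame`: on a finite arena without dead ends there is ONE pair
of legal positional strategies `σ` (Even) and `τ` (Odd) such that from every vertex either `σ`
beats every legal strategy with memory of Odd or `τ` beats every legal strategy with memory of
Even (N. Fijalkow, F. Horn, *Games on Graphs*, Ch. 2 "Regular games", §3, Theorem "Positional
determinacy and complexity of parity games"; originally Emerson–Jutla 1991, Mostowski 1991,
McNaughton 1993, Zielonka 1998).

We follow the printed proof (the McNaughton–Zielonka recursion), with the two simplifications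
that plays are handled as bare sequences `ρ : ℕ → V` ("consistent with the positional strategy
`σ` at the vertices of its owner, along edges at the other vertices") and that subgames are vertex
sets `S : Finset V` of the ambient arena in which every vertex keeps a successor (plays of the
subgame = plays staying in `S`):

* §1 (attractors = Ch. 2 §1, Lemma "Characterisation of the winning region of reachability games
  using attractors"): the approximants `attrN` (`Attr^k`), their stabilisation, the attractor
  `attr` of a target `T` for a player inside `S`, its rank function and attractor strategy
  `attrStrat`, the facts that every consistent play from the attractor reaches `T`
  (`attr_reach`) and that the complement of an attractor is a sub-arena the attracting player
  cannot enter (`succ_not_mem_attr`, `exists_succ_not_mem_attr`, `subarena_sdiff_attr`);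
* §2: `IsSolution o p E S W σ τ` — "`W` / `S \ W` are won by the positional `σ` / `τ` against
  every behaviour of the opponent inside `S`" — with the confrontation argument (a play cannot
  be lost by both players) showing that `τ` never enters `W` and Even cannot enter `W` from
  `S \ W` (`IsSolution.not_mem_of_step`), the empty game, and DUALITY (swap the players and
  shift priorities by one, `IsSolution.of_dual`), which replaces the source's remark that the
  lemma for an odd top priority "is the exact dual" of the one for an even top priority;
* §3 = Ch. 2 §3, Lemma "Fixed point characterisation of the winning regions for parity games"
  (the case of an even top priority `d`): with `T = p⁻¹(d) ∩ S`, `A = Attr_Even(T)` and a solution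
  of `S \ A`, either Odd wins nothing there and Even wins everywhere on `S`
  (`isSolution_of_attr_univ`: a consistent play visits `A`, hence `T`, infinitely often, or is
  eventually a play of `S \ A`), or `B = Attr_Odd(X)` of Odd's region `X` is removed and a
  solution of `S \ B` is glued with the attractor strategy and Odd's strategy on `X`
  (`isSolution_of_attr_attr`);
* §4: `exists_isSolution` by strong induction on `S` (odd top priority via duality) and the
  discharge `ParityGame.PositionalDeterminacy_holds` (take `S = univ` and feed the play generated
  by the opponent's strategy with memory).

## References

* [FH23] N. Fijalkow, F. Horn, Ch. 2 "Regular games" of N. Fijalkow et al., *Games on Graphs*,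
  arXiv:2305.10546 (2023): §1 (attractors, traps, sub-games), §3 Thm "Positional determinacy and
  complexity of parity games" and its two lemmas. [`FijalkowEtAl2023GamesOnGraphs`]
* W. Zielonka, Infinite games on finitely coloured graphs with applications to automata on
  infinite trees, TCS 200 (1998) 135–183 (the recursion); R. McNaughton, Infinite games played
  on finite graphs, APAL 65 (1993).
-/

namespace Literature.Combinatorics.Games.ParityGame

open Filter

open scoped Classical

universe u

variable {V : Type u}

/-! ## §0 Plays: prefix independence, prepending a vertex, gluing strategies -/

/-- Owner dichotomy: every Boolean is `a` or `!a`. [folklore] -/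
theorem eq_or_eq_not (a b : Bool) : b = a ∨ b = !a := by
  cases a <;> cases b <;> decide

section Plays

variable [Fintype V]

/-- **Prefix independence:** shifting a play does not change the set of vertices it visits
infinitely often. [folklore] -/
theorem infinitelyOften_comp_add (ρ : ℕ → V) (k : ℕ) :
    infinitelyOften (fun t => ρ (t + k)) = infinitelyOften ρ := by
  ext u
  simp only [mem_infinitelyOften, Filter.frequently_atTop]
  constructor
  · intro h n
    obtain ⟨b, hb, hbu⟩ := h n
    exact ⟨b + k, by omega, hbu⟩
  · intro h n
    obtain ⟨b, hb, hbu⟩ := h (n + k)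
    refine ⟨b - k, by omega, ?_⟩
    have hbk : b - k + k = b := by omega
    rw [hbk]
    exact hbu

/-- A vertex visited infinitely often by a play staying in `S` lies in `S`. [folklore] -/
theorem infinitelyOften_subset {S : Finset V} {ρ : ℕ → V} (hρ : ∀ t, ρ t ∈ S) :
    infinitelyOften ρ ⊆ S := by
  intro w hw
  obtain ⟨t, ht⟩ := (mem_infinitelyOften.1 hw).exists
  rw [← ht]
  exact hρ t

omit [Fintype V] in
/-- Shifting all priorities by one shifts the top priority by one (`sup` of a translate over a
nonempty finset). [folklore] -/
theorem sup_succ {C : Finset V} (hC : C.Nonempty) (p : V → ℕ) :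
    (C.sup fun u => p u + 1) = C.sup p + 1 := by
  apply le_antisymm
  · exact Finset.sup_le fun u hu => Nat.add_le_add_right (Finset.le_sup hu) 1
  · obtain ⟨u₀, hu₀, h0⟩ := Finset.exists_mem_eq_sup C hC p
    rw [h0]
    exact Finset.le_sup (f := fun u => p u + 1) hu₀

omit [Fintype V] in
/-- Pigeonhole: a play which is infinitely often in a finite set `T` visits some vertex of `T`
infinitely often. [folklore] -/
theorem exists_mem_frequently_eq {T : Finset V} {ρ : ℕ → V}
    (h : ∃ᶠ t : ℕ in atTop, ρ t ∈ T) : ∃ u ∈ T, ∃ᶠ t : ℕ in atTop, ρ t = u := by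
  by_contra hcon
  have hev : ∀ u ∈ T, ∀ᶠ t : ℕ in atTop, ¬ ρ t = u := fun u hu =>
    Filter.not_frequently.mp fun hf => hcon ⟨u, hu, hf⟩
  rw [← Filter.eventually_all_finset] at hev
  obtain ⟨t, ht, ht'⟩ := (h.and_eventually hev).exists
  exact ht' (ρ t) ht rfl

end Plays

/-- The play `u, ρ 0, ρ 1, …` obtained by prepending the vertex `u` to the play `ρ`.
[folklore] -/
def consPlay (u : V) (ρ : ℕ → V) : ℕ → V
  | 0 => u
  | t + 1 => ρ t

/-- `consPlay u ρ` starts at `u`. [folklore] -/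
@[simp] theorem consPlay_zero (u : V) (ρ : ℕ → V) : consPlay u ρ 0 = u := rfl

/-- `consPlay u ρ` then continues as `ρ`. [folklore] -/
@[simp] theorem consPlay_succ (u : V) (ρ : ℕ → V) (t : ℕ) : consPlay u ρ (t + 1) = ρ t := rfl

/-- Prepending a vertex does not change the vertices visited infinitely often. [folklore] -/
theorem infinitelyOften_consPlay [Fintype V] (u : V) (ρ : ℕ → V) :
    infinitelyOften (consPlay u ρ) = infinitelyOften ρ := by
  rw [← infinitelyOften_comp_add (consPlay u ρ) 1]
  rfl

/-- Gluing positional strategies by regions: `f` on `R`, `g` elsewhere (the "disjoint unions of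
strategies" of the source). [cite: FijalkowEtAl2023GamesOnGraphs, Ch. 2 §3, proof of Lemma
"Fixed point characterisation of the winning regions for parity games"] -/
noncomputable def glue (R : Finset V) (f g : V → V) : V → V :=
  fun u => if u ∈ R then f u else g u

/-- `glue` on the region. [folklore] -/
theorem glue_of_mem {R : Finset V} (f g : V → V) {u : V} (h : u ∈ R) : glue R f g u = f u :=
  if_pos h

/-- `glue` off the region. [folklore] -/
theorem glue_of_not_mem {R : Finset V} (f g : V → V) {u : V} (h : u ∉ R) : glue R f g u = g u :=
  if_neg h

/-- Some `E`-successor inside `S` (a default legal positional move; the vertex itself if there is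
none). [folklore] -/
noncomputable def someSucc (E : V → V → Prop) (S : Finset V) (u : V) : V :=
  if h : ∃ w ∈ S, E u w then h.choose else u

/-- `someSucc` is a legal move inside `S` whenever one exists. [folklore] -/
theorem someSucc_spec {E : V → V → Prop} {S : Finset V} {u : V} (h : ∃ w ∈ S, E u w) :
    someSucc E S u ∈ S ∧ E u (someSucc E S u) := by
  rw [someSucc, dif_pos h]
  exact h.choose_spec

/-! ## §1 Attractors inside a sub-arena

Throughout, `S` is the vertex set of the current subgame, the player is `a : Bool` (she owns the
vertices `u` with `o u = a`, her opponent those with `o u = !a`), and only moves inside `S`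
count. [cite: FijalkowEtAl2023GamesOnGraphs, Ch. 2 §1] -/

section Attractor

variable (o : V → Bool) (E : V → V → Prop) (a : Bool) (S : Finset V)

/-- One step `X ↦ X ∪ Pre_a(X)` of the attractor computation inside `S`: add the vertices of
player `a` having an edge into `X` and the vertices of the opponent all of whose edges inside `S`
lead into `X`. [cite: FijalkowEtAl2023GamesOnGraphs, Ch. 2 §1 (the operator
`X ↦ Win ∪ Pre(X)`)] -/
noncomputable def attrStep (X : Finset V) : Finset V :=
  X ∪ S.filter fun u =>
    (o u = a ∧ ∃ w ∈ S, E u w ∧ w ∈ X) ∨ (o u = !a ∧ ∀ w ∈ S, E u w → w ∈ X)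

variable (T : Finset V)

/-- The approximants `Attr^k(T)` of the attractor of `T` for player `a` inside `S`.
[cite: FijalkowEtAl2023GamesOnGraphs, Ch. 2 §1 (the sequence `Attr^k`)] -/
noncomputable def attrN : ℕ → Finset V
  | 0 => T
  | k + 1 => attrStep o E a S (attrN k)

variable {o E a S T}

/-- `Attr^0 = T`. [folklore] -/
theorem attrN_zero : attrN o E a S T 0 = T := rfl

/-- `Attr^{k+1} = Attr^k ∪ Pre(Attr^k)`. [folklore] -/
theorem attrN_succ (k : ℕ) : attrN o E a S T (k + 1) = attrStep o E a S (attrN o E a S T k) := rfl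

/-- Membership in one attractor step. [folklore] -/
theorem mem_attrStep {X : Finset V} {u : V} :
    u ∈ attrStep o E a S X ↔ u ∈ X ∨ (u ∈ S ∧ ((o u = a ∧ ∃ w ∈ S, E u w ∧ w ∈ X) ∨
      (o u = !a ∧ ∀ w ∈ S, E u w → w ∈ X))) := by
  simp only [attrStep, Finset.mem_union, Finset.mem_filter]

/-- The attractor step is inflationary. [folklore] -/
theorem subset_attrStep (X : Finset V) : X ⊆ attrStep o E a S X := Finset.subset_union_left

/-- The attractor step stays inside `T ∪ S`. [folklore] -/
theorem attrStep_subset_union {X : Finset V} (hX : X ⊆ T ∪ S) : attrStep o E a S X ⊆ T ∪ S :=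
  Finset.union_subset hX ((Finset.filter_subset _ _).trans Finset.subset_union_right)

/-- The approximants increase. [folklore] -/
theorem attrN_subset_succ (k : ℕ) : attrN o E a S T k ⊆ attrN o E a S T (k + 1) :=
  subset_attrStep _

/-- The approximants form a monotone sequence. [folklore] -/
theorem attrN_mono : Monotone (attrN o E a S T) := monotone_nat_of_le_succ attrN_subset_succ

/-- The approximants stay inside `T ∪ S`. [folklore] -/
theorem attrN_subset_union (k : ℕ) : attrN o E a S T k ⊆ T ∪ S := by
  induction k with
  | zero => exact Finset.subset_union_left
  | succ k ih => exact attrStep_subset_union ih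

variable (o E a S T) in
/-- On a finite vertex type the approximants stabilise ("after at most `n - 1` steps"; we only
need that they do). [cite: FijalkowEtAl2023GamesOnGraphs, Ch. 2 §1] -/
theorem attrN_stabilises : ∃ N, attrN o E a S T (N + 1) = attrN o E a S T N := by
  by_contra h
  push Not at h
  have key : ∀ N, N ≤ (attrN o E a S T N).card := by
    intro N
    induction N with
    | zero => exact Nat.zero_le _
    | succ N ih =>
      have hss : attrN o E a S T N ⊂ attrN o E a S T (N + 1) :=
        Finset.ssubset_iff_subset_ne.2 ⟨attrN_subset_succ N, (h N).symm⟩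
      exact Nat.succ_le_of_lt (lt_of_le_of_lt ih (Finset.card_lt_card hss))
  have h1 := (key ((T ∪ S).card + 1)).trans (Finset.card_le_card (attrN_subset_union _))
  omega

variable (o E a S T) in
/-- **The attractor** `Attr_a(T)` of `T` for player `a` inside `S`: the stable approximant.
[cite: FijalkowEtAl2023GamesOnGraphs, Ch. 2 §1 (definition of `Attr`)] -/
noncomputable def attr : Finset V := attrN o E a S T (Nat.find (attrN_stabilises o E a S T))

/-- The attractor is a fixed point of the attractor step. [folklore] -/
theorem attrStep_attr : attrStep o E a S (attr o E a S T) = attr o E a S T := by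
  rw [attr, ← attrN_succ]
  exact Nat.find_spec (attrN_stabilises o E a S T)

/-- `T ⊆ Attr(T)`. [folklore] -/
theorem subset_attr : T ⊆ attr o E a S T := by
  rw [attr]
  exact attrN_mono (Nat.zero_le _)

/-- `Attr(T) ⊆ S` when `T ⊆ S`. [folklore] -/
theorem attr_subset (hT : T ⊆ S) : attr o E a S T ⊆ S := by
  have h := attrN_subset_union (o := o) (E := E) (a := a) (S := S) (T := T)
    (Nat.find (attrN_stabilises o E a S T))
  rw [Finset.union_eq_right.2 hT] at h
  exact h

/-- Every approximant is contained in the attractor. [folklore] -/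
theorem attrN_subset_attr (k : ℕ) : attrN o E a S T k ⊆ attr o E a S T := by
  have hstab : ∀ j,
      attrN o E a S T (Nat.find (attrN_stabilises o E a S T) + j) = attr o E a S T := by
    intro j
    induction j with
    | zero => rfl
    | succ j ih =>
      rw [← add_assoc, attrN_succ, ih]
      exact attrStep_attr
  rcases le_total k (Nat.find (attrN_stabilises o E a S T)) with hk | hk
  · rw [attr]
    exact attrN_mono hk
  · obtain ⟨j, rfl⟩ := Nat.exists_eq_add_of_le hk
    exact (hstab j).le

/-- Closure of the attractor under controlled predecessors, player-`a` vertices: a vertex of `a`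
in `S` with an edge into the attractor is in the attractor. [folklore] -/
theorem mem_attr_of_exists {u w : V} (hu : u ∈ S) (ho : o u = a) (hw : w ∈ S) (hE : E u w)
    (hwA : w ∈ attr o E a S T) : u ∈ attr o E a S T := by
  rw [← attrStep_attr, mem_attrStep]
  exact Or.inr ⟨hu, Or.inl ⟨ho, w, hw, hE, hwA⟩⟩

/-- Closure of the attractor under controlled predecessors, opponent vertices. [folklore] -/
theorem mem_attr_of_forall {u : V} (hu : u ∈ S) (ho : o u = !a)
    (h : ∀ w ∈ S, E u w → w ∈ attr o E a S T) : u ∈ attr o E a S T := by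
  rw [← attrStep_attr, mem_attrStep]
  exact Or.inr ⟨hu, Or.inr ⟨ho, h⟩⟩

/-- **The complement of an attractor is a trap for the attracting player:** her edges from
`S \ Attr` inside `S` stay in `S \ Attr`. [cite: FijalkowEtAl2023GamesOnGraphs, Ch. 2 §1,
"Subgames"] -/
theorem succ_not_mem_attr {u w : V} (hu : u ∈ S) (huA : u ∉ attr o E a S T) (ho : o u = a)
    (hw : w ∈ S) (hE : E u w) : w ∉ attr o E a S T :=
  fun hwA => huA (mem_attr_of_exists hu ho hw hE hwA)

/-- … and the opponent can always stay in `S \ Attr` (the "counter-attractor strategy").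
[cite: FijalkowEtAl2023GamesOnGraphs, Ch. 2 §1, Lemma "Characterisation of the winning region
of reachability games using attractors", second item] -/
theorem exists_succ_not_mem_attr {u : V} (hu : u ∈ S) (huA : u ∉ attr o E a S T)
    (ho : o u = !a) : ∃ w ∈ S, E u w ∧ w ∉ attr o E a S T := by
  by_contra h
  push Not at h
  exact huA (mem_attr_of_forall hu ho h)

/-- Hence the complement of an attractor inside a sub-arena is again a sub-arena (every vertex
keeps a successor). [cite: FijalkowEtAl2023GamesOnGraphs, Ch. 2 §1, "Subgames"] -/
theorem subarena_sdiff_attr (hS : ∀ u ∈ S, ∃ w ∈ S, E u w) :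
    ∀ u ∈ S \ attr o E a S T, ∃ w ∈ S \ attr o E a S T, E u w := by
  intro u hu
  rw [Finset.mem_sdiff] at hu
  rcases eq_or_eq_not a (o u) with ho | ho
  · obtain ⟨w, hw, hE⟩ := hS u hu.1
    exact ⟨w, Finset.mem_sdiff.2 ⟨hw, succ_not_mem_attr hu.1 hu.2 ho hw hE⟩, hE⟩
  · obtain ⟨w, hw, hE, hwA⟩ := exists_succ_not_mem_attr hu.1 hu.2 ho
    exact ⟨w, Finset.mem_sdiff.2 ⟨hw, hwA⟩, hE⟩

variable (o E a S T) in
/-- The **rank** of a vertex: the least `k` with `u ∈ Attr^k(T)` (and `0` off the attractor).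
[cite: FijalkowEtAl2023GamesOnGraphs, Ch. 2 §1 ("the rank of `v` is the smallest `k` such that
`v ∈ Attr^k(Win)`")] -/
noncomputable def attrRank (u : V) : ℕ :=
  if h : ∃ k, u ∈ attrN o E a S T k then Nat.find h else 0

/-- Vertices of the attractor lie in some approximant. [folklore] -/
theorem exists_mem_attrN_of_mem_attr {u : V} (hu : u ∈ attr o E a S T) :
    ∃ k, u ∈ attrN o E a S T k := by
  rw [attr] at hu
  exact ⟨_, hu⟩

/-- A vertex of the attractor lies in the approximant of its rank. [folklore] -/
theorem mem_attrN_attrRank {u : V} (h : ∃ k, u ∈ attrN o E a S T k) :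
    u ∈ attrN o E a S T (attrRank o E a S T u) := by
  rw [attrRank, dif_pos h]
  exact Nat.find_spec h

/-- The rank is at most any level containing the vertex. [folklore] -/
theorem attrRank_le {u : V} {k : ℕ} (hk : u ∈ attrN o E a S T k) : attrRank o E a S T u ≤ k := by
  rw [attrRank, dif_pos ⟨k, hk⟩]
  exact Nat.find_min' _ hk

/-- A vertex of `Attr^{k+1} \ T` entered at some level `j + 1 ≤ k + 1` through the predecessor
condition with respect to `Attr^j`. [folklore] -/
theorem exists_cond_of_mem_attrN_succ {k : ℕ} {u : V} (hu : u ∈ attrN o E a S T (k + 1))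
    (huT : u ∉ T) :
    ∃ j ≤ k, u ∈ S ∧ ((o u = a ∧ ∃ w ∈ S, E u w ∧ w ∈ attrN o E a S T j) ∨
      (o u = !a ∧ ∀ w ∈ S, E u w → w ∈ attrN o E a S T j)) := by
  induction k with
  | zero =>
    rw [attrN_succ, mem_attrStep] at hu
    rcases hu with hu | hu
    · exact absurd hu huT
    · exact ⟨0, le_rfl, hu⟩
  | succ k ih =>
    rw [attrN_succ, mem_attrStep] at hu
    rcases hu with hu | hu
    · obtain ⟨j, hj, h⟩ := ih hu
      exact ⟨j, hj.trans (Nat.le_succ k), h⟩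
    · exact ⟨k + 1, le_rfl, hu⟩

/-- **Rank decreases along the attractor:** from a vertex of `Attr \ T`, its owner `a` has an
edge inside `S` to a vertex of smaller rank, and every edge of the opponent inside `S` leads to a
vertex of smaller rank. [cite: FijalkowEtAl2023GamesOnGraphs, Ch. 2 §1, proof of Lemma
"Characterisation of the winning region of reachability games using attractors"] -/
theorem attr_moves {u : V} (hu : u ∈ attr o E a S T) (huT : u ∉ T) :
    (o u = a ∧ ∃ w ∈ S, E u w ∧ w ∈ attr o E a S T ∧ attrRank o E a S T w < attrRank o E a S T u) ∨
    (o u = !a ∧ ∀ w ∈ S, E u w → w ∈ attr o E a S T ∧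
      attrRank o E a S T w < attrRank o E a S T u) := by
  have hex : ∃ k, u ∈ attrN o E a S T k := exists_mem_attrN_of_mem_attr hu
  have hr := mem_attrN_attrRank hex
  have hr0 : attrRank o E a S T u ≠ 0 := by
    intro h0
    rw [h0] at hr
    exact huT hr
  obtain ⟨r, hr'⟩ : ∃ r, attrRank o E a S T u = r + 1 := ⟨attrRank o E a S T u - 1, by omega⟩
  rw [hr'] at hr
  obtain ⟨j, hj, -, hcond⟩ := exists_cond_of_mem_attrN_succ hr huT
  refine hcond.imp ?_ ?_
  · rintro ⟨ho, w, hw, hE, hwj⟩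
    exact ⟨ho, w, hw, hE, attrN_subset_attr j hwj, (attrRank_le hwj).trans_lt (by omega)⟩
  · rintro ⟨ho, hall⟩
    exact ⟨ho, fun w hw hE => ⟨attrN_subset_attr j (hall w hw hE),
      (attrRank_le (hall w hw hE)).trans_lt (by omega)⟩⟩

variable (o E a S T) in
/-- **The attractor strategy** of player `a`: from a vertex of `Attr \ T` move inside `S` to a
vertex of the attractor of smaller rank (elsewhere: stay put; it is only used on `Attr \ T`).
[cite: FijalkowEtAl2023GamesOnGraphs, Ch. 2 §1, Lemma "Characterisation of the winning region
of reachability games using attractors", first item] -/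
noncomputable def attrStrat (u : V) : V :=
  if h : ∃ w ∈ S, E u w ∧ w ∈ attr o E a S T ∧ attrRank o E a S T w < attrRank o E a S T u
  then h.choose else u

/-- The attractor strategy is legal inside `S` on `Attr \ T` and decreases the rank.
[folklore] -/
theorem attrStrat_spec {u : V} (hu : u ∈ attr o E a S T) (huT : u ∉ T) (ho : o u = a) :
    attrStrat o E a S T u ∈ S ∧ E u (attrStrat o E a S T u) ∧
      attrStrat o E a S T u ∈ attr o E a S T ∧
      attrRank o E a S T (attrStrat o E a S T u) < attrRank o E a S T u := by
  have h : ∃ w ∈ S, E u w ∧ w ∈ attr o E a S T ∧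
      attrRank o E a S T w < attrRank o E a S T u := by
    rcases attr_moves hu huT with ⟨-, h⟩ | ⟨ho', -⟩
    · exact h
    · exact absurd (ho.symm.trans ho') (Bool.self_ne_not a)
  rw [attrStrat, dif_pos h]
  exact h.choose_spec

/-- Opponent moves inside `S` from `Attr \ T` stay in the attractor and decrease the rank.
[folklore] -/
theorem attr_opponent_move {u w : V} (hu : u ∈ attr o E a S T) (huT : u ∉ T) (ho : o u = !a)
    (hw : w ∈ S) (hE : E u w) :
    w ∈ attr o E a S T ∧ attrRank o E a S T w < attrRank o E a S T u := by
  rcases attr_moves hu huT with ⟨ho', -⟩ | ⟨-, h⟩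
  · exact absurd (ho'.symm.trans ho) (Bool.self_ne_not a)
  · exact h w hw hE

/-- **Attractor lemma** (Ch. 2 §1, Lemma "Characterisation of the winning region of
reachability games using attractors", first item): a play inside `S` which follows the
attractor strategy at the player-`a` vertices of `Attr \ T` and moves along edges at the
opponent's vertices reaches `T` after every visit to the attractor.
[cite: FijalkowEtAl2023GamesOnGraphs, Ch. 2 §1, Lemma "Characterisation of the winning region
of reachability games using attractors", first item] -/
theorem attr_reach {ρ : ℕ → V} (hS : ∀ t, ρ t ∈ S)
    (hfollow : ∀ t, ρ t ∈ attr o E a S T → ρ t ∉ T → o (ρ t) = a →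
      ρ (t + 1) = attrStrat o E a S T (ρ t))
    (hlegal : ∀ t, o (ρ t) = !a → E (ρ t) (ρ (t + 1))) {t₀ : ℕ}
    (h₀ : ρ t₀ ∈ attr o E a S T) : ∃ t, t₀ ≤ t ∧ ρ t ∈ T := by
  suffices H : ∀ n t₀, ρ t₀ ∈ attr o E a S T → attrRank o E a S T (ρ t₀) ≤ n →
      ∃ t, t₀ ≤ t ∧ ρ t ∈ T from H _ t₀ h₀ le_rfl
  intro n
  induction n with
  | zero =>
    intro t₀ h₀ hr
    refine ⟨t₀, le_rfl, ?_⟩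
    have h := mem_attrN_attrRank (exists_mem_attrN_of_mem_attr h₀)
    rw [Nat.le_zero.1 hr] at h
    exact h
  | succ n ih =>
    intro t₀ h₀ hr
    by_cases hT : ρ t₀ ∈ T
    · exact ⟨t₀, le_rfl, hT⟩
    · have hnext : ρ (t₀ + 1) ∈ attr o E a S T ∧ attrRank o E a S T (ρ (t₀ + 1)) ≤ n := by
        rcases eq_or_eq_not a (o (ρ t₀)) with ho | ho
        · have hs := attrStrat_spec h₀ hT ho
          rw [hfollow t₀ h₀ hT ho]
          exact ⟨hs.2.2.1, Nat.lt_succ_iff.1 (hs.2.2.2.trans_le hr)⟩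
        · have hm := attr_opponent_move h₀ hT ho (hS (t₀ + 1)) (hlegal t₀ ho)
          exact ⟨hm.1, Nat.lt_succ_iff.1 (hm.2.trans_le hr)⟩
      obtain ⟨t, ht, hT'⟩ := ih (t₀ + 1) hnext.1 hnext.2
      exact ⟨t, (Nat.le_succ t₀).trans ht, hT'⟩

end Attractor


/-! ## §2 Solutions of a subgame, confrontation, duality -/

section Solution

variable [Fintype V] {o : V → Bool} {p : V → ℕ} {E : V → V → Prop}

/-- **A positional solution of the subgame on `S`.** `W ⊆ S` is Even's region, `σ` and `τ` are
positional strategies of Even and Odd which are legal and stay inside `S` at the vertices of `S`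
of their owner, every play staying in `S` from `W` which follows `σ` at Even's vertices and moves
along edges at Odd's vertices has an even top priority (largest priority visited infinitely
often), and every play staying in `S` from `S \ W` which follows `τ` at Odd's vertices and moves
along edges at Even's vertices has an odd top priority. For `S = univ` this is "`(σ, τ)` is a
pair of uniform positional winning strategies and `W = W_Eve`, `S \ W = W_Adam`".
[cite: FijalkowEtAl2023GamesOnGraphs, Ch. 1 §5 (uniform positional determinacy) and Ch. 2 §3] -/
structure IsSolution (o : V → Bool) (p : V → ℕ) (E : V → V → Prop) (S W : Finset V)
    (σ τ : V → V) : Prop where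
  /-- Even's region lies in the subgame. -/
  subset : W ⊆ S
  /-- Even's strategy is legal and stays in `S`. -/
  even_legal : ∀ u ∈ S, o u = true → E u (σ u) ∧ σ u ∈ S
  /-- Odd's strategy is legal and stays in `S`. -/
  odd_legal : ∀ u ∈ S, o u = false → E u (τ u) ∧ τ u ∈ S
  /-- `σ` wins from `W` against every behaviour of Odd inside `S`. -/
  even_wins : ∀ ρ : ℕ → V, (∀ t, ρ t ∈ S) → ρ 0 ∈ W →
    (∀ t, o (ρ t) = true → ρ (t + 1) = σ (ρ t)) →
    (∀ t, o (ρ t) = false → E (ρ t) (ρ (t + 1))) → Even ((infinitelyOften ρ).sup p)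
  /-- `τ` wins from `S \ W` against every behaviour of Even inside `S`. -/
  odd_wins : ∀ ρ : ℕ → V, (∀ t, ρ t ∈ S) → ρ 0 ∉ W →
    (∀ t, o (ρ t) = false → ρ (t + 1) = τ (ρ t)) →
    (∀ t, o (ρ t) = true → E (ρ t) (ρ (t + 1))) → Odd ((infinitelyOften ρ).sup p)

omit [Fintype V] in
/-- The orbit of `positionalPlay o σ τ` from a vertex of `S` stays in `S` when both strategies
do. [folklore] -/
theorem iterate_positionalPlay_mem {S : Finset V} {σ τ : V → V}
    (hσ : ∀ u ∈ S, o u = true → σ u ∈ S) (hτ : ∀ u ∈ S, o u = false → τ u ∈ S) {w : V}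
    (hw : w ∈ S) (t : ℕ) : (positionalPlay o σ τ)^[t] w ∈ S := by
  induction t with
  | zero => exact hw
  | succ t ih =>
    rw [Function.iterate_succ_apply']
    cases ho : o ((positionalPlay o σ τ)^[t] w) with
    | false =>
      rw [positionalPlay_of_eq_false _ _ ho]
      exact hτ _ ih ho
    | true =>
      rw [positionalPlay_of_eq_true _ _ ho]
      exact hσ _ ih ho

/-- **Confrontation** (the two regions of a solution cannot be crossed against the strategies):
if `u ∈ S \ W` and `w ∈ S` is a successor of `u` which is legal for Even if `u` is Even's and is
`τ u` if `u` is Odd's, then `w ∉ W`. Otherwise the play `u, w, (σ, τ)-play from w` would be lost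
by both players ("Eve and Adam cannot have a winning strategy from the same vertex").
[cite: FijalkowEtAl2023GamesOnGraphs, Ch. 1 §1, Fact "Winning regions are disjoint"] -/
theorem IsSolution.not_mem_of_step {S W : Finset V} {σ τ : V → V}
    (sol : IsSolution o p E S W σ τ) {u w : V} (hu : u ∈ S) (huW : u ∉ W) (hw : w ∈ S)
    (hσu : o u = true → E u w) (hτu : o u = false → w = τ u) : w ∉ W := by
  intro hwW
  set π : ℕ → V := fun t => (positionalPlay o σ τ)^[t] w with hπ
  have hπS : ∀ t, π t ∈ S := iterate_positionalPlay_mem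
    (fun u hu h => (sol.even_legal u hu h).2) (fun u hu h => (sol.odd_legal u hu h).2) hw
  have hπσ : ∀ t, o (π t) = true → π (t + 1) = σ (π t) := fun t ht => by
    simp only [hπ]
    rw [Function.iterate_succ_apply', positionalPlay_of_eq_true _ _ ht]
  have hπτ : ∀ t, o (π t) = false → π (t + 1) = τ (π t) := fun t ht => by
    simp only [hπ]
    rw [Function.iterate_succ_apply', positionalPlay_of_eq_false _ _ ht]
  have heven : Even ((infinitelyOften π).sup p) :=
    sol.even_wins π hπS hwW hπσ fun t ht => by
      rw [hπτ t ht]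
      exact (sol.odd_legal _ (hπS t) ht).1
  have hodd : Odd ((infinitelyOften π).sup p) := by
    rw [← infinitelyOften_consPlay u π]
    refine sol.odd_wins (consPlay u π) ?_ huW ?_ ?_
    · intro t
      cases t with
      | zero => exact hu
      | succ t => exact hπS t
    · intro t ht
      cases t with
      | zero => exact hτu ht
      | succ t => exact hπτ t ht
    · intro t ht
      cases t with
      | zero => exact hσu ht
      | succ t =>
        show E (π t) (π (t + 1))
        rw [hπσ t ht]
        exact (sol.even_legal _ (hπS t) ht).1
  exact (Nat.not_even_iff_odd.2 hodd) heven

/-- Odd's strategy never enters Even's region from outside it.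
[cite: FijalkowEtAl2023GamesOnGraphs, Ch. 1 §1, Fact "Winning regions are disjoint"] -/
theorem IsSolution.apply_not_mem {S W : Finset V} {σ τ : V → V}
    (sol : IsSolution o p E S W σ τ) {u : V} (hu : u ∈ S) (huW : u ∉ W) (ho : o u = false) :
    τ u ∉ W :=
  sol.not_mem_of_step hu huW (sol.odd_legal u hu ho).2
    (fun h => Bool.noConfusion (ho.symm.trans h)) fun _ => rfl

/-- Even cannot enter her region from outside it.
[cite: FijalkowEtAl2023GamesOnGraphs, Ch. 1 §1, Fact "Winning regions are disjoint"] -/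
theorem IsSolution.succ_not_mem {S W : Finset V} {σ τ : V → V}
    (sol : IsSolution o p E S W σ τ) {u w : V} (hu : u ∈ S) (huW : u ∉ W) (ho : o u = true)
    (hw : w ∈ S) (hE : E u w) : w ∉ W :=
  sol.not_mem_of_step hu huW hw (fun _ => hE) fun h => Bool.noConfusion (ho.symm.trans h)

variable (o p E) in
/-- The empty subgame is solved by anything. [folklore] -/
theorem isSolution_empty : IsSolution o p E ∅ ∅ id id where
  subset := Finset.Subset.refl _
  even_legal := fun u hu => absurd hu (Finset.notMem_empty u)
  odd_legal := fun u hu => absurd hu (Finset.notMem_empty u)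
  even_wins := fun _ _ h0 => absurd h0 (Finset.notMem_empty _)
  odd_wins := fun _ hS => absurd (hS 0) (Finset.notMem_empty _)

/-- **Duality** (the source's "the proof is the same swapping the two players"): a solution of
the game with owners swapped and priorities shifted by one is a solution of the original game
with the regions and strategies swapped. [cite: FijalkowEtAl2023GamesOnGraphs, Ch. 2 §3,
Lemma "Dual fixed point characterisation of the winning regions for parity games"] -/
theorem IsSolution.of_dual {S W : Finset V} {σ τ : V → V}
    (sol : IsSolution (fun u => !o u) (fun u => p u + 1) E S W σ τ) :
    IsSolution o p E S (S \ W) τ σ where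
  subset := Finset.sdiff_subset
  even_legal := fun u hu ho => sol.odd_legal u hu (by simp [ho])
  odd_legal := fun u hu ho => sol.even_legal u hu (by simp [ho])
  even_wins := by
    intro ρ hρS h0 hτ hlegal
    have h0' : ρ 0 ∉ W := fun h => (Finset.mem_sdiff.1 h0).2 h
    have h := sol.odd_wins ρ hρS h0' (fun t ho => hτ t (Bool.eq_true_of_not_eq_false' ho))
      fun t ho => hlegal t (Bool.eq_false_of_not_eq_true' ho)
    rw [sup_succ (infinitelyOften_nonempty ρ) p, Nat.odd_add_one,
      Nat.not_odd_iff_even] at h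
    exact h
  odd_wins := by
    intro ρ hρS h0 hσ hlegal
    have h0' : ρ 0 ∈ W := by
      by_contra h
      exact h0 (Finset.mem_sdiff.2 ⟨hρS 0, h⟩)
    have h := sol.even_wins ρ hρS h0' (fun t ho => hσ t (Bool.eq_false_of_not_eq_true' ho))
      fun t ho => hlegal t (Bool.eq_true_of_not_eq_false' ho)
    rw [sup_succ (infinitelyOften_nonempty ρ) p, Nat.even_add_one,
      Nat.not_even_iff_odd] at h
    exact h

end Solution

/-! ## §3 The Zielonka step for an even top priority -/

section Step

variable [Fintype V] {o : V → Bool} {p : V → ℕ} {E : V → V → Prop}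

/-- **Fixed point characterisation, first item.** Let `d` be even and bound the priorities on
`S`, let `T ⊆ S` consist of vertices of priority `d`, `A = Attr_Even(T)` inside `S`, and suppose
Even wins the whole subgame `S \ A` with `σ'`. Then Even wins all of `S` with "`σ'` on `S \ A`,
the attractor strategy on `A \ T`, any legal move on `T`": a consistent play either visits `A` —
hence, by the attractor lemma, `T` — infinitely often, so that its top priority is `d`, or it is
eventually a play of `S \ A` consistent with `σ'`. [cite: FijalkowEtAl2023GamesOnGraphs,
Ch. 2 §3, Lemma "Fixed point characterisation of the winning regions for parity games", first
item] -/
theorem isSolution_of_attr_univ {S T W' : Finset V} {σ' τ' : V → V}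
    (hS : ∀ u ∈ S, ∃ w ∈ S, E u w) {d : ℕ} (hd : Even d) (hpd : ∀ u ∈ S, p u ≤ d)
    (hTd : ∀ u ∈ T, d ≤ p u) (sol' : IsSolution o p E (S \ attr o E true S T) W' σ' τ')
    (hW' : S \ attr o E true S T ⊆ W') :
    IsSolution o p E S S
      (glue (S \ attr o E true S T) σ' (glue T (someSucc E S) (attrStrat o E true S T)))
      (someSucc E S) where
  subset := Finset.Subset.refl S
  even_legal := by
    intro u hu ho
    by_cases h1 : u ∈ S \ attr o E true S T
    · rw [glue_of_mem _ _ h1]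
      have h := sol'.even_legal u h1 ho
      exact ⟨h.1, (Finset.mem_sdiff.1 h.2).1⟩
    · rw [glue_of_not_mem _ _ h1]
      by_cases h2 : u ∈ T
      · rw [glue_of_mem _ _ h2]
        have h := someSucc_spec (hS u hu)
        exact ⟨h.2, h.1⟩
      · rw [glue_of_not_mem _ _ h2]
        have huA : u ∈ attr o E true S T := by
          by_contra h
          exact h1 (Finset.mem_sdiff.2 ⟨hu, h⟩)
        have h := attrStrat_spec huA h2 ho
        exact ⟨h.2.1, h.1⟩
  odd_legal := fun u hu _ => ⟨(someSucc_spec (hS u hu)).2, (someSucc_spec (hS u hu)).1⟩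
  even_wins := by
    intro ρ hρS _ hσ hlegal
    by_cases hfreq : ∃ᶠ t : ℕ in atTop, ρ t ∈ attr o E true S T
    · -- the attractor, hence `T`, is visited infinitely often: top priority `d`
      have hfollow : ∀ t, ρ t ∈ attr o E true S T → ρ t ∉ T → o (ρ t) = true →
          ρ (t + 1) = attrStrat o E true S T (ρ t) := by
        intro t htA htT ho
        have hnot : ρ t ∉ S \ attr o E true S T := fun h => (Finset.mem_sdiff.1 h).2 htA
        rw [hσ t ho, glue_of_not_mem _ _ hnot, glue_of_not_mem _ _ htT]
      have hT : ∃ᶠ t : ℕ in atTop, ρ t ∈ T := by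
        rw [Filter.frequently_atTop] at hfreq ⊢
        intro N
        obtain ⟨t₀, ht₀, hA⟩ := hfreq N
        obtain ⟨t, ht, hT⟩ :=
          attr_reach hρS hfollow (fun t ho => hlegal t (ho.trans rfl)) hA
        exact ⟨t, ht₀.trans ht, hT⟩
      obtain ⟨u, huT, hu⟩ := exists_mem_frequently_eq hT
      have hge : d ≤ (infinitelyOften ρ).sup p :=
        (hTd u huT).trans (Finset.le_sup (mem_infinitelyOften.2 hu))
      have hle : (infinitelyOften ρ).sup p ≤ d :=
        Finset.sup_le fun w hw => hpd w (infinitelyOften_subset hρS hw)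
      rw [le_antisymm hle hge]
      exact hd
    · -- eventually the play stays in `S \ A`, where it is consistent with `σ'`
      rw [Filter.not_frequently, Filter.eventually_atTop] at hfreq
      obtain ⟨N, hN⟩ := hfreq
      have hmem : ∀ t, ρ (t + N) ∈ S \ attr o E true S T := fun t =>
        Finset.mem_sdiff.2 ⟨hρS _, hN _ (Nat.le_add_left N t)⟩
      have hcons : ∀ t, o (ρ (t + N)) = true → ρ (t + 1 + N) = σ' (ρ (t + N)) := by
        intro t ho
        rw [Nat.add_right_comm, hσ (t + N) ho, glue_of_mem _ _ (hmem t)]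
      have hleg : ∀ t, o (ρ (t + N)) = false → E (ρ (t + N)) (ρ (t + 1 + N)) := by
        intro t ho
        rw [Nat.add_right_comm]
        exact hlegal (t + N) ho
      have h := sol'.even_wins (fun t => ρ (t + N)) hmem (hW' (hmem 0)) hcons hleg
      rwa [infinitelyOften_comp_add] at h
  odd_wins := fun ρ hρS h0 _ _ => absurd (hρS 0) h0

/-- **Fixed point characterisation, second item (with the strategies made explicit).** Let
`T ⊆ S`, `A = Attr_Even(T)`, `(W', σ', τ')` a solution of `S \ A` with Odd's region
`X = (S \ A) \ W'`, `B = Attr_Odd(X)` inside `S`, and `(W'', σ'', τ'')` a solution of `S \ B`.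
Then `W''` together with "`σ''` on `S \ B`, anything legal on `B`" for Even and "`τ''` on
`S \ B`, `τ'` on `X`, the attractor strategy on `B \ X`" for Odd solves `S`: Even's plays from
`W''` never leave the trap `S \ B`; Odd's plays from `S \ W''` either stay in `S \ B` (and are
consistent with `τ''`) or enter `B`, then reach `X` and stay there forever, consistent with
`τ'`.
[cite: FijalkowEtAl2023GamesOnGraphs, Ch. 2 §3, Lemma "Fixed point characterisation of the
winning regions for parity games", second item] -/
theorem isSolution_of_attr_attr {S T W' W'' : Finset V} {σ' τ' σ'' τ'' : V → V}
    (hS : ∀ u ∈ S, ∃ w ∈ S, E u w)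
    (sol' : IsSolution o p E (S \ attr o E true S T) W' σ' τ')
    (sol'' : IsSolution o p E
      (S \ attr o E false S ((S \ attr o E true S T) \ W')) W'' σ'' τ'') :
    IsSolution o p E S W''
      (glue (S \ attr o E false S ((S \ attr o E true S T) \ W')) σ'' (someSucc E S))
      (glue (S \ attr o E false S ((S \ attr o E true S T) \ W')) τ''
        (glue ((S \ attr o E true S T) \ W') τ'
          (attrStrat o E false S ((S \ attr o E true S T) \ W')))) := by
  set A := attr o E true S T
  set X := (S \ A) \ W'
  set B := attr o E false S X
  have hXB : X ⊆ B := subset_attr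
  exact {
    subset := sol''.subset.trans Finset.sdiff_subset
    even_legal := by
      intro u hu ho
      by_cases h1 : u ∈ S \ B
      · rw [glue_of_mem _ _ h1]
        have h := sol''.even_legal u h1 ho
        exact ⟨h.1, (Finset.mem_sdiff.1 h.2).1⟩
      · rw [glue_of_not_mem _ _ h1]
        exact ⟨(someSucc_spec (hS u hu)).2, (someSucc_spec (hS u hu)).1⟩
    odd_legal := by
      intro u hu ho
      by_cases h1 : u ∈ S \ B
      · rw [glue_of_mem _ _ h1]
        have h := sol''.odd_legal u h1 ho
        exact ⟨h.1, (Finset.mem_sdiff.1 h.2).1⟩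
      · rw [glue_of_not_mem _ _ h1]
        by_cases h2 : u ∈ X
        · rw [glue_of_mem _ _ h2]
          have h := sol'.odd_legal u (Finset.mem_sdiff.1 h2).1 ho
          exact ⟨h.1, (Finset.mem_sdiff.1 h.2).1⟩
        · rw [glue_of_not_mem _ _ h2]
          have huB : u ∈ B := by
            by_contra h
            exact h1 (Finset.mem_sdiff.2 ⟨hu, h⟩)
          have h := attrStrat_spec huB h2 ho
          exact ⟨h.2.1, h.1⟩
    even_wins := by
      intro ρ hρS h0 hσ hlegal
      -- `S \ B` is a trap for Odd and `σ''` stays inside it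
      have hstay : ∀ t, ρ t ∈ S \ B := by
        intro t
        induction t with
        | zero => exact sol''.subset h0
        | succ t ih =>
          have hu := Finset.mem_sdiff.1 ih
          cases ho : o (ρ t) with
          | false =>
            exact Finset.mem_sdiff.2
              ⟨hρS _, succ_not_mem_attr hu.1 hu.2 ho (hρS _) (hlegal t ho)⟩
          | true =>
            rw [hσ t ho, glue_of_mem _ _ ih]
            exact (sol''.even_legal _ ih ho).2
      exact sol''.even_wins ρ hstay h0 (fun t ho => by rw [hσ t ho, glue_of_mem _ _ (hstay t)])
        hlegal
    odd_wins := by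
      intro ρ hρS h0 hτ hlegal
      by_cases hvis : ∃ t, ρ t ∈ B
      · -- the play enters `B`, reaches `X` and stays there, consistent with `τ'`
        obtain ⟨t₀, ht₀⟩ := hvis
        have hfollow : ∀ t, ρ t ∈ B → ρ t ∉ X → o (ρ t) = false →
            ρ (t + 1) = attrStrat o E false S X (ρ t) := by
          intro t htB htX ho
          have hnot : ρ t ∉ S \ B := fun h => (Finset.mem_sdiff.1 h).2 htB
          rw [hτ t ho, glue_of_not_mem _ _ hnot, glue_of_not_mem _ _ htX]
        obtain ⟨t₁, -, ht₁⟩ :=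
          attr_reach hρS hfollow (fun t ho => hlegal t (ho.trans rfl)) ht₀
        have hstayX : ∀ s, ρ (s + t₁) ∈ X := by
          intro s
          induction s with
          | zero => rwa [Nat.zero_add]
          | succ s ih =>
            rw [Nat.add_right_comm]
            have hu := Finset.mem_sdiff.1 ih
            have hu1 := Finset.mem_sdiff.1 hu.1
            cases ho : o (ρ (s + t₁)) with
            | false =>
              have hnot : ρ (s + t₁) ∉ S \ B := fun h => (Finset.mem_sdiff.1 h).2 (hXB ih)
              rw [hτ _ ho, glue_of_not_mem _ _ hnot, glue_of_mem _ _ ih]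
              exact Finset.mem_sdiff.2
                ⟨(sol'.odd_legal _ hu.1 ho).2, sol'.apply_not_mem hu.1 hu.2 ho⟩
            | true =>
              have hE := hlegal _ ho
              have hw : ρ (s + t₁ + 1) ∈ S \ A :=
                Finset.mem_sdiff.2 ⟨hρS _, succ_not_mem_attr hu1.1 hu1.2 ho (hρS _) hE⟩
              exact Finset.mem_sdiff.2 ⟨hw, sol'.succ_not_mem hu.1 hu.2 ho hw hE⟩
        have hcons : ∀ s, o (ρ (s + t₁)) = false → ρ (s + 1 + t₁) = τ' (ρ (s + t₁)) := by
          intro s ho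
          have hnot : ρ (s + t₁) ∉ S \ B := fun h => (Finset.mem_sdiff.1 h).2 (hXB (hstayX s))
          rw [Nat.add_right_comm, hτ _ ho, glue_of_not_mem _ _ hnot, glue_of_mem _ _ (hstayX s)]
        have hleg : ∀ s, o (ρ (s + t₁)) = true → E (ρ (s + t₁)) (ρ (s + 1 + t₁)) := by
          intro s ho
          rw [Nat.add_right_comm]
          exact hlegal _ ho
        have h := sol'.odd_wins (fun s => ρ (s + t₁)) (fun s => (Finset.mem_sdiff.1 (hstayX s)).1)
          (Finset.mem_sdiff.1 (hstayX 0)).2 hcons hleg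
        rwa [infinitelyOften_comp_add] at h
      · -- the play stays in `S \ B`, consistent with `τ''`
        push Not at hvis
        have hstay : ∀ t, ρ t ∈ S \ B := fun t => Finset.mem_sdiff.2 ⟨hρS t, hvis t⟩
        exact sol''.odd_wins ρ hstay h0
          (fun t ho => by rw [hτ t ho, glue_of_mem _ _ (hstay t)]) hlegal }

/-- **The Zielonka step, even top priority** (the source's fixed point characterisation
assembled with its two recursive calls, i.e. one round of `SolveEven`): if every proper
sub-arena of `S` is solved and the largest priority on the
nonempty sub-arena `S` is even, then `S` is solved. [cite: FijalkowEtAl2023GamesOnGraphs,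
Ch. 2 §3, Lemma "Fixed point characterisation of the winning regions for parity games" and
Algorithm "SolveEven"] -/
theorem step_even {S : Finset V} (hne : S.Nonempty) (hS : ∀ u ∈ S, ∃ w ∈ S, E u w)
    (hd : Even (S.sup p))
    (ih : ∀ S' ⊂ S, (∀ u ∈ S', ∃ w ∈ S', E u w) →
      ∃ (W : Finset V) (σ τ : V → V), IsSolution o p E S' W σ τ) :
    ∃ (W : Finset V) (σ τ : V → V), IsSolution o p E S W σ τ := by
  set d := S.sup p
  set T := S.filter (fun u => p u = d)
  have hTS : T ⊆ S := Finset.filter_subset _ _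
  have hTd : ∀ u ∈ T, d ≤ p u := fun u hu => (Finset.mem_filter.1 hu).2.ge
  have hpd : ∀ u ∈ S, p u ≤ d := fun u hu => Finset.le_sup hu
  have hTne : T.Nonempty := by
    obtain ⟨u, hu, hsup⟩ := Finset.exists_mem_eq_sup S hne p
    exact ⟨u, Finset.mem_filter.2 ⟨hu, hsup.symm⟩⟩
  -- first recursive call: the subgame `S \ Attr_Even(T)`
  have hA : attr o E true S T ⊆ S := attr_subset hTS
  have hS'lt : S \ attr o E true S T ⊂ S := Finset.sdiff_ssubset hA (hTne.mono subset_attr)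
  obtain ⟨W', σ', τ', sol'⟩ := ih _ hS'lt (subarena_sdiff_attr hS)
  by_cases hXe : S \ attr o E true S T ⊆ W'
  · exact ⟨S, _, _, isSolution_of_attr_univ hS hd hpd hTd sol' hXe⟩
  · -- second recursive call: the subgame `S \ Attr_Odd(X)`, `X` = Odd's region of the first
    have hXne : ((S \ attr o E true S T) \ W').Nonempty := Finset.sdiff_nonempty.2 hXe
    have hXS : (S \ attr o E true S T) \ W' ⊆ S := Finset.sdiff_subset.trans Finset.sdiff_subset
    have hB : attr o E false S ((S \ attr o E true S T) \ W') ⊆ S := attr_subset hXS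
    have hS''lt : S \ attr o E false S ((S \ attr o E true S T) \ W') ⊂ S :=
      Finset.sdiff_ssubset hB (hXne.mono subset_attr)
    obtain ⟨W'', σ'', τ'', sol''⟩ := ih _ hS''lt (subarena_sdiff_attr hS)
    exact ⟨W'', _, _, isSolution_of_attr_attr hS sol' sol''⟩

end Step

/-! ## §4 Solving every sub-arena; the discharge -/

section Main

variable [Fintype V]

/-- **Every sub-arena of a finite parity game has a positional solution** (Zielonka's recursion:
strong induction on the vertex set, the case of an odd top priority being reduced to the even
case by duality). [cite: FijalkowEtAl2023GamesOnGraphs, Ch. 2 §3, Thm "Positional determinacy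
and complexity of parity games" (proof) and Algorithm "A recursive algorithm for computing the
winning regions of parity games"] -/
theorem exists_isSolution (E : V → V → Prop) (S : Finset V) :
    ∀ (o : V → Bool) (p : V → ℕ), (∀ u ∈ S, ∃ w ∈ S, E u w) →
      ∃ (W : Finset V) (σ τ : V → V), IsSolution o p E S W σ τ := by
  induction S using Finset.strongInduction with
  | H S ih =>
    intro o p hS
    rcases S.eq_empty_or_nonempty with rfl | hne
    · exact ⟨∅, id, id, isSolution_empty o p E⟩
    · by_cases hd : Even (S.sup p)
      · exact step_even hne hS hd fun S' hS' hS'a => ih S' hS' o p hS'a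
      · have hd' : Even (S.sup fun u => p u + 1) := by
          rw [sup_succ hne p, Nat.even_add_one]
          exact hd
        obtain ⟨W, σ, τ, sol⟩ :=
          step_even (o := fun u => !o u) hne hS hd' fun S' hS' hS'a => ih S' hS' _ _ hS'a
        exact ⟨S \ W, τ, σ, sol.of_dual⟩

end Main

/-- **Positional determinacy of parity games on finite arenas** — discharge of the named fact
`ParityGame.PositionalDeterminacy`: solve the whole arena (`S = univ`) and feed the resulting
positional strategy of the winner, against an arbitrary legal strategy with memory of the
opponent, the play they generate. [cite: FijalkowEtAl2023GamesOnGraphs, Ch. 2 §3, Thm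
"Positional determinacy and complexity of parity games"] -/
theorem PositionalDeterminacy_holds : PositionalDeterminacy.{u} := by
  intro W _ o p E hE
  obtain ⟨R, σ, τ, sol⟩ := exists_isSolution E Finset.univ o p
    fun u _ => let ⟨w, hw⟩ := hE u; ⟨w, Finset.mem_univ w, hw⟩
  refine ⟨σ, τ, fun u hu => (sol.even_legal u (Finset.mem_univ u) hu).1,
    fun u hu => (sol.odd_legal u (Finset.mem_univ u) hu).1, fun v => ?_⟩
  by_cases hv : v ∈ R
  · refine Or.inl fun τ' hτ' => sol.even_wins _ (fun _ => Finset.mem_univ _) hv ?_ ?_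
    · intro t ht
      rw [play_succ, if_pos ht, ofPositional_apply]
    · intro t ht
      rw [play_succ, if_neg (fun h => Bool.noConfusion (ht.symm.trans h))]
      exact hτ' _ _ ht
  · refine Or.inr fun σ' hσ' => sol.odd_wins _ (fun _ => Finset.mem_univ _) hv ?_ ?_
    · intro t ht
      rw [play_succ, if_neg (fun h => Bool.noConfusion (ht.symm.trans h)), ofPositional_apply]
    · intro t ht
      rw [play_succ, if_pos ht]
      exact hσ' _ _ ht

end Literature.Combinatorics.Games.ParityGame
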